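import Literature.AlgebraicGeometry.Frobenioids.BiratUnitsDiv
import HarnessLib

/-!
# [FrdI] Prop. 4.4 (ii)–(iii): a SPLIT unit sequence gives `O^×(A^birat) ≃ O^×(A) × Φ^birat(A)`

Mochizuki, *The geometry of Frobenioids I: the general theory*, Kyushu J. Math. **62** (2008)
293–400, §4, Proposition 4.4 (ii)–(iii), kurims text p. 83 [cite: MochizukiFrdI2008, Prop. 4.4 p.83]:
"a surjection `O^×(A^birat) ↠ Φ^birat(A^birat)` whose kernel is the image … of `O^×(A)`" — i.e. the
exact sequence of groups

  `1 → O^×(A) —(unitsToBirat)→ O^×(A^birat) —(divHom)→ Φ^birat(A) → 1`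

(`BiratUnitsDiv.lean`: `unitsToBirat_injective`, `ker_divHom_eq_range`, `divHomRange`).  This
PROOF-SUPPORT file records the elementary group theory used by [FrdII] Thm. 3.6 (i) (kurims p. 36,
"rational function monoid naturally isomorphic to `(Φ^fld)^Λ`", `Φ^fld = Φ^gp × Φ^∡`): whenever the
divisor map admits a multiplicative SECTION `σ` commuting with the units (automatic when
`O^×(A^birat)` is abelian, e.g. for `A` birationally Frobenius-normalized —
`BiratUnits.mul_comm_of_isBiratFrobeniusNormalized`), the sequence splits as a DIRECT PRODUCT
[cite: MochizukiFrdII2008, Thm 3.6 (i) p.36] (abc-iut cell, layer L1, row M13-c3 piece P2 FILE B of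
HOME/staging/L1/L1-t6/g3/M13-c3-DESIGN.md; generic algebra supplied by abc-iut-w5-d194):

* `splitProdMulEquiv i d s …` — for ANY split short exact sequence of groups
  `1 → U —i→ B —d→ G` (`i` injective, `range i = ker d`) with a section homomorphism `s` of `d`
  (`d ∘ s = id`; so `d` is onto) such that `i(U)` and `s(G)` commute: `B ≃* U × G`,
  `b ↦ (i⁻¹(b · s(d b)⁻¹), d b)`, inverse `(u, g) ↦ i u · s g` (`splitProdMulEquiv_symm_apply`,
  `snd_splitProdMulEquiv`, `inl_fst_splitProdMulEquiv_mul`);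
* `BiratUnits.splitProd σ …` — the case `i = unitsToBirat`, `d = divHom` with a section over ALL of
  `Φ^gp(A)` (then `Φ^birat(A) = Φ^gp(A)`): `O^×(A^birat) ≃* O^×(A) × Φ^gp(A)`;
* `BiratUnits.splitProdRange σ …` — the case of a section over the image `Φ^birat(A) = divHomRange`
  only: `O^×(A^birat) ≃* O^×(A) × divHomRange`;
* the `Nonempty` (def-free) forms `nonempty_mulEquiv_prod_of_section(_range)`.
Classical algebra; no statement of the paper is strengthened; nothing here bears on [IUTchIII].
-/

namespace Literature.AlgebraicGeometry.Frobenioids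

open Function

/-! ### Generic: a split short exact sequence of groups with commuting splitting is a product -/

section SplitExact

variable {U B G : Type*} [Group U] [Group B] [Group G]
  (i : U →* B) (d : B →* G) (s : G →* B)

/-- The multiplication map `U × G → B`, `(u, g) ↦ i u · s g`, a homomorphism as soon as `i(U)` and
`s(G)` commute. (folklore group theory behind FrdI Prop. 4.4 (iii)) [cite: MochizukiFrdI2008, Prop. 4.4 (iii) p.83] -/
def mulOfSplit (hcomm : ∀ (u : U) (g : G), i u * s g = s g * i u) : U × G →* B where
  toFun x := i x.1 * s x.2
  map_one' := by rw [Prod.fst_one, Prod.snd_one, map_one, map_one, one_mul]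
  map_mul' x y := by
    rw [Prod.fst_mul, Prod.snd_mul, map_mul, map_mul, mul_assoc, mul_assoc, ← mul_assoc (i y.1),
      hcomm y.1 x.2, mul_assoc]

/-- `mulOfSplit` on elements. (folklore group theory behind FrdI Prop. 4.4 (iii)) [cite: MochizukiFrdI2008, Prop. 4.4 (iii) p.83] -/
@[simp] theorem mulOfSplit_apply (hcomm : ∀ (u : U) (g : G), i u * s g = s g * i u) (x : U × G) :
    mulOfSplit i s hcomm x = i x.1 * s x.2 := rfl

variable {i d s}

/-- `d` kills `i(U)` when `range i = ker d`. (folklore group theory behind FrdI Prop. 4.4 (iii)) [cite: MochizukiFrdI2008, Prop. 4.4 (iii) p.83] -/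
theorem apply_inl_eq_one (hrange : i.range = d.ker) (u : U) : d (i u) = 1 := by
  have h : i u ∈ d.ker := hrange ▸ ⟨u, rfl⟩
  exact h

/-- `mulOfSplit` is injective: apply `d` to get the `G`-components equal, then cancel. (folklore group theory behind FrdI Prop. 4.4 (iii)) [cite: MochizukiFrdI2008, Prop. 4.4 (iii) p.83] -/
theorem mulOfSplit_injective (hi : Injective i) (hrange : i.range = d.ker) (hs : ∀ g, d (s g) = g)
    (hcomm : ∀ (u : U) (g : G), i u * s g = s g * i u) : Injective (mulOfSplit i s hcomm) := by
  rintro ⟨u, g⟩ ⟨u', g'⟩ h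
  have h' : i u * s g = i u' * s g' := h
  have hg : g = g' := by
    have := congrArg d h'
    rwa [map_mul, map_mul, apply_inl_eq_one hrange, apply_inl_eq_one hrange, one_mul, one_mul, hs,
      hs] at this
  subst hg
  exact Prod.ext (hi (mul_right_cancel h')) rfl

/-- `mulOfSplit` is surjective: `b · s(d b)⁻¹ ∈ ker d = range i`. (folklore group theory behind FrdI Prop. 4.4 (iii)) [cite: MochizukiFrdI2008, Prop. 4.4 (iii) p.83] -/
theorem mulOfSplit_surjective (hrange : i.range = d.ker) (hs : ∀ g, d (s g) = g)
    (hcomm : ∀ (u : U) (g : G), i u * s g = s g * i u) : Surjective (mulOfSplit i s hcomm) := by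
  intro b
  have hk : b * (s (d b))⁻¹ ∈ d.ker := by
    rw [MonoidHom.mem_ker, map_mul, map_inv, hs, mul_inv_cancel]
  rw [← hrange] at hk
  obtain ⟨u, hu⟩ := hk
  exact ⟨(u, d b), by rw [mulOfSplit_apply, hu, inv_mul_cancel_right]⟩

variable (i d s)

/-- **A split short exact sequence with commuting splitting is a direct product**: for groups
`1 → U —i→ B —d→ G` with `i` injective, `range i = ker d`, a section homomorphism `s` of `d` and
`i(U)`, `s(G)` commuting, `B ≃* U × G` (inverse to `(u, g) ↦ i u · s g`). (folklore group theory behind FrdI Prop. 4.4 (iii)) [cite: MochizukiFrdI2008, Prop. 4.4 (iii) p.83] -/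
noncomputable def splitProdMulEquiv (hi : Injective i) (hrange : i.range = d.ker)
    (hs : ∀ g, d (s g) = g) (hcomm : ∀ (u : U) (g : G), i u * s g = s g * i u) : B ≃* U × G :=
  (MulEquiv.ofBijective (mulOfSplit i s hcomm)
    ⟨mulOfSplit_injective hi hrange hs hcomm, mulOfSplit_surjective hrange hs hcomm⟩).symm

variable {i d s} (hi : Injective i) (hrange : i.range = d.ker) (hs : ∀ g, d (s g) = g)
  (hcomm : ∀ (u : U) (g : G), i u * s g = s g * i u)

/-- The inverse of `splitProdMulEquiv` is `(u, g) ↦ i u · s g`. (folklore group theory behind FrdI Prop. 4.4 (iii)) [cite: MochizukiFrdI2008, Prop. 4.4 (iii) p.83] -/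
@[simp] theorem splitProdMulEquiv_symm_apply (x : U × G) :
    (splitProdMulEquiv i d s hi hrange hs hcomm).symm x = i x.1 * s x.2 := by
  rw [splitProdMulEquiv, MulEquiv.symm_symm, MulEquiv.ofBijective_apply, mulOfSplit_apply]

/-- Reassembling `b` from its components. (folklore group theory behind FrdI Prop. 4.4 (iii)) [cite: MochizukiFrdI2008, Prop. 4.4 (iii) p.83] -/
theorem inl_fst_mul_s_snd (b : B) :
    i (splitProdMulEquiv i d s hi hrange hs hcomm b).1 *
        s (splitProdMulEquiv i d s hi hrange hs hcomm b).2 = b := by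
  rw [← splitProdMulEquiv_symm_apply hi hrange hs hcomm, MulEquiv.symm_apply_apply]

/-- The `G`-component of `splitProdMulEquiv b` is `d b`. (folklore group theory behind FrdI Prop. 4.4 (iii)) [cite: MochizukiFrdI2008, Prop. 4.4 (iii) p.83] -/
@[simp] theorem snd_splitProdMulEquiv (b : B) : (splitProdMulEquiv i d s hi hrange hs hcomm b).2 = d b := by
  have h := congrArg d (inl_fst_mul_s_snd hi hrange hs hcomm b)
  rwa [map_mul, apply_inl_eq_one hrange, one_mul, hs] at h

/-- The `U`-component of `splitProdMulEquiv b`, pushed into `B`, is `b · s(d b)⁻¹`. (folklore group theory behind FrdI Prop. 4.4 (iii)) [cite: MochizukiFrdI2008, Prop. 4.4 (iii) p.83] -/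
theorem inl_fst_splitProdMulEquiv (b : B) :
    i (splitProdMulEquiv i d s hi hrange hs hcomm b).1 = b * (s (d b))⁻¹ := by
  rw [eq_mul_inv_iff_mul_eq, ← snd_splitProdMulEquiv hi hrange hs hcomm b]
  exact inl_fst_mul_s_snd hi hrange hs hcomm b

/-- `splitProdMulEquiv` on `i u` is `(u, 1)`. (folklore group theory behind FrdI Prop. 4.4 (iii)) [cite: MochizukiFrdI2008, Prop. 4.4 (iii) p.83] -/
@[simp] theorem splitProdMulEquiv_inl (u : U) : splitProdMulEquiv i d s hi hrange hs hcomm (i u) = (u, 1) := by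
  rw [MulEquiv.apply_eq_iff_symm_apply, splitProdMulEquiv_symm_apply, map_one, mul_one]

/-- `splitProdMulEquiv` on `s g` is `(1, g)`. (folklore group theory behind FrdI Prop. 4.4 (iii)) [cite: MochizukiFrdI2008, Prop. 4.4 (iii) p.83] -/
@[simp] theorem splitProdMulEquiv_section (g : G) :
    splitProdMulEquiv i d s hi hrange hs hcomm (s g) = (1, g) := by
  rw [MulEquiv.apply_eq_iff_symm_apply, splitProdMulEquiv_symm_apply, map_one, one_mul]

/-- In an ABELIAN middle group every splitting commutes with the units. (folklore group theory behind FrdI Prop. 4.4 (iii)) [cite: MochizukiFrdI2008, Prop. 4.4 (iii) p.83] -/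
theorem comm_of_mul_comm (hB : ∀ x y : B, x * y = y * x) (u : U) (g : G) : i u * s g = s g * i u :=
  hB _ _

end SplitExact

/-! ### The unit sequence of `A^birat` -/

namespace PreFrobenioid

open CategoryTheory Opposite

universe w v v' u u'

variable {D : Type u} [Category.{v} D] {Φ : Dᵒᵖ ⥤ CommMonCat.{w}}
  {C : Type u'} [Category.{v'} C] {F : C ⥤ ElemFrobenioid Φ}

namespace BiratUnits

variable {hF : IsFrobenioid F} {A : C}

/-- **Prop. 4.4 (ii)–(iii), split form over `Φ^gp(A)`**: a multiplicative section `σ` of the divisor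
map `O^×(A^birat) → Φ^gp(A)` defined on all of `Φ^gp(A)` (so `Φ^birat(A) = Φ^gp(A)`) and commuting
with the units `O^×(A) ⊆ O^×(A^birat)` yields `O^×(A^birat) ≃* O^×(A) × Φ^gp(A)`, inverse to
`(u, x) ↦ u · σ x`. [cite: MochizukiFrdI2008, Prop. 4.4 (iii) p.83] -/
noncomputable def splitProd (σ : PhiGp F A →* BiratUnits F hF A) (hσ : ∀ x, divHom hF A (σ x) = x)
    (hcomm : ∀ (u : unitsSubgroup F A) (x : PhiGp F A),
      unitsToBirat hF A u * σ x = σ x * unitsToBirat hF A u) :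
    BiratUnits F hF A ≃* unitsSubgroup F A × PhiGp F A :=
  splitProdMulEquiv (unitsToBirat hF A) (divHom hF A) σ unitsToBirat_injective
    ker_divHom_eq_range.symm hσ hcomm

/-- The inverse of `splitProd`: `(u, x) ↦ u · σ x`. [cite: MochizukiFrdI2008, Prop. 4.4 (iii) p.83] -/
@[simp] theorem splitProd_symm_apply (σ : PhiGp F A →* BiratUnits F hF A)
    (hσ : ∀ x, divHom hF A (σ x) = x)
    (hcomm : ∀ (u : unitsSubgroup F A) (x : PhiGp F A),
      unitsToBirat hF A u * σ x = σ x * unitsToBirat hF A u) (z : unitsSubgroup F A × PhiGp F A) :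
    (splitProd σ hσ hcomm).symm z = unitsToBirat hF A z.1 * σ z.2 :=
  splitProdMulEquiv_symm_apply _ _ _ _ z

/-- The second component of `splitProd` is the divisor. [cite: MochizukiFrdI2008, Prop. 4.4 (iii) p.83] -/
@[simp] theorem snd_splitProd (σ : PhiGp F A →* BiratUnits F hF A) (hσ : ∀ x, divHom hF A (σ x) = x)
    (hcomm : ∀ (u : unitsSubgroup F A) (x : PhiGp F A),
      unitsToBirat hF A u * σ x = σ x * unitsToBirat hF A u) (b : BiratUnits F hF A) :
    (splitProd σ hσ hcomm b).2 = divHom hF A b :=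
  snd_splitProdMulEquiv _ _ _ _ b

/-- Units go to `(u, 0)`. [cite: MochizukiFrdI2008, Prop. 4.4 (ii) p.83] -/
@[simp] theorem splitProd_unitsToBirat (σ : PhiGp F A →* BiratUnits F hF A)
    (hσ : ∀ x, divHom hF A (σ x) = x)
    (hcomm : ∀ (u : unitsSubgroup F A) (x : PhiGp F A),
      unitsToBirat hF A u * σ x = σ x * unitsToBirat hF A u) (u : unitsSubgroup F A) :
    splitProd σ hσ hcomm (unitsToBirat hF A u) = (u, 1) :=
  splitProdMulEquiv_inl _ _ _ _ u

/-- **Prop. 4.4 (ii)–(iii), split form over the image `Φ^birat(A)`**: a multiplicative section `σ` of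
`O^×(A^birat) ↠ divHomRange` commuting with the units yields
`O^×(A^birat) ≃* O^×(A) × divHomRange`. [cite: MochizukiFrdI2008, Prop. 4.4 (iii) p.83] -/
noncomputable def splitProdRange (σ : divHomRange hF A →* BiratUnits F hF A)
    (hσ : ∀ x, divHom hF A (σ x) = x)
    (hcomm : ∀ (u : unitsSubgroup F A) (x : divHomRange hF A),
      unitsToBirat hF A u * σ x = σ x * unitsToBirat hF A u) :
    BiratUnits F hF A ≃* unitsSubgroup F A × divHomRange hF A :=
  splitProdMulEquiv (unitsToBirat hF A) (divHom hF A).rangeRestrict σ unitsToBirat_injective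
    (by rw [MonoidHom.ker_rangeRestrict]; exact ker_divHom_eq_range.symm)
    (fun x => Subtype.ext (by rw [MonoidHom.coe_rangeRestrict]; exact hσ x)) hcomm

/-- The inverse of `splitProdRange`: `(u, x) ↦ u · σ x`. [cite: MochizukiFrdI2008, Prop. 4.4 (iii) p.83] -/
@[simp] theorem splitProdRange_symm_apply (σ : divHomRange hF A →* BiratUnits F hF A)
    (hσ : ∀ x, divHom hF A (σ x) = x)
    (hcomm : ∀ (u : unitsSubgroup F A) (x : divHomRange hF A),
      unitsToBirat hF A u * σ x = σ x * unitsToBirat hF A u)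
    (z : unitsSubgroup F A × divHomRange hF A) :
    (splitProdRange σ hσ hcomm).symm z = unitsToBirat hF A z.1 * σ z.2 :=
  splitProdMulEquiv_symm_apply _ _ _ _ z

/-- The second component of `splitProdRange` is the divisor. [cite: MochizukiFrdI2008, Prop. 4.4 (iii) p.83] -/
theorem coe_snd_splitProdRange (σ : divHomRange hF A →* BiratUnits F hF A)
    (hσ : ∀ x, divHom hF A (σ x) = x)
    (hcomm : ∀ (u : unitsSubgroup F A) (x : divHomRange hF A),
      unitsToBirat hF A u * σ x = σ x * unitsToBirat hF A u) (b : BiratUnits F hF A) :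
    ((splitProdRange σ hσ hcomm b).2 : PhiGp F A) = divHom hF A b := by
  have h := snd_splitProdMulEquiv (i := unitsToBirat hF A) (d := (divHom hF A).rangeRestrict) (s := σ)
    unitsToBirat_injective (by rw [MonoidHom.ker_rangeRestrict]; exact ker_divHom_eq_range.symm)
    (fun x => Subtype.ext (by rw [MonoidHom.coe_rangeRestrict]; exact hσ x)) hcomm b
  exact congrArg Subtype.val h

/-- DEF-FREE form over `Φ^gp(A)`: if `O^×(A^birat)` is abelian and the divisor map has a section over
`Φ^gp(A)`, then `O^×(A^birat) ≅ O^×(A) × Φ^gp(A)`. [cite: MochizukiFrdI2008, Prop. 4.4 (iii) p.83] -/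
theorem nonempty_mulEquiv_prod_of_section (hab : ∀ x y : BiratUnits F hF A, x * y = y * x)
    (σ : PhiGp F A →* BiratUnits F hF A) (hσ : ∀ x, divHom hF A (σ x) = x) :
    Nonempty (BiratUnits F hF A ≃* unitsSubgroup F A × PhiGp F A) :=
  ⟨splitProd σ hσ fun _ _ => hab _ _⟩

/-- DEF-FREE form over `Φ^birat(A)`: if `O^×(A^birat)` is abelian and `O^×(A^birat) ↠ Φ^birat(A)` has a
multiplicative section, then `O^×(A^birat) ≅ O^×(A) × Φ^birat(A)`.
[cite: MochizukiFrdI2008, Prop. 4.4 (iii) p.83] -/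
theorem nonempty_mulEquiv_prod_of_section_range (hab : ∀ x y : BiratUnits F hF A, x * y = y * x)
    (σ : divHomRange hF A →* BiratUnits F hF A) (hσ : ∀ x, divHom hF A (σ x) = x) :
    Nonempty (BiratUnits F hF A ≃* unitsSubgroup F A × divHomRange hF A) :=
  ⟨splitProdRange σ hσ fun _ _ => hab _ _⟩

end BiratUnits

end PreFrobenioid

end Literature.AlgebraicGeometry.Frobenioids

-- build enqueue (comment-only re-land 2026-08-26T07:4xZ, STRANDED-ACCEPT remedy per ops/buildfix pattern; no declaration changed)
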